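import Summits.Ventures.QEC.Census.CertBZPlaneSeg2
import Summits.Ventures.QEC.Census.BB.A1s_n162_k8_760084bf.Cert
import HarnessLib

/-!
# `A1s_n162_k8_760084bf` — side Z lane FAMILIES, packed module 37/37 (qec-search-10 g4 packfam.py: parts BZPlaneFamZ3m1p8;
# Σ lanes 8380007, 2 theorems) at tier KERNEL — type-01 lane engine δ (`Plane.segOK` / `Plane.seg2OK`, Census/CertBZPlaneSeg2.lean);
# assembled by the block files `BZPlaneBlkZP*.lean`. First part's header:
# # `A1s_n162_k8_760084bf` — certificate `44d0b10264f73d6b…`, side Z, block 3, matrix 1 (depth 6, 81 rows): lane FAMILIES part 9/9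
# # (2 theorems, Σ lanes 8380007) at tier KERNEL — type-01 lane engine δ (`Plane.segOK` one-level segments for largest rows `< 40`;
# # per larger row a singleton + `Plane.seg2OK` second-row ranges, Census/CertBZPlaneSeg2.lean); assembled by `BZPlaneBlkZ03.lean` (qec-search-10 g3 emit_bbrow.py)
-/

set_option autoImplicit false
set_option Elab.async false

namespace Summit.Ventures.QEC.Census.A1s_n162_k8_760084bf

open Summit.Ventures.QEC.Census Summit.Ventures.QEC.Census.Plane

set_option maxHeartbeats 400000000 in
/-- Block 3, matrix 1: largest row 80, second-largest in `[74, 77)`, ≤ 4 below — every such selection passes (3860254 lanes; KERNEL). -/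
theorem pseg2_3_1_96 : Plane.seg2OK 162 13 (A1s_n162_k8_760084bf.cert.sideZ.found.map Prod.fst) (giRows (gbRows A1s_n162_k8_760084bf.cert.HZ A1s_n162_k8_760084bf.bzAutData.rcZ A1s_n162_k8_760084bf.bzAutData.LZ A1s_n162_k8_760084bf.bzAutBlockZ3) (A1s_n162_k8_760084bf.bzAutBlockZ3.mats.getD 1 { T := [], A := [], t := 0 })) 6 80 74 3 3518 = true := by decide +kernel

set_option maxHeartbeats 400000000 in
/-- Block 3, matrix 1: largest row 80, second-largest in `[77, 80)`, ≤ 4 below — every such selection passes (4519753 lanes; KERNEL). -/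
theorem pseg2_3_1_97 : Plane.seg2OK 162 13 (A1s_n162_k8_760084bf.cert.sideZ.found.map Prod.fst) (giRows (gbRows A1s_n162_k8_760084bf.cert.HZ A1s_n162_k8_760084bf.bzAutData.rcZ A1s_n162_k8_760084bf.bzAutData.LZ A1s_n162_k8_760084bf.bzAutBlockZ3) (A1s_n162_k8_760084bf.bzAutBlockZ3.mats.getD 1 { T := [], A := [], t := 0 })) 6 80 77 3 3518 = true := by decide +kernel

end Summit.Ventures.QEC.Census.A1s_n162_k8_760084bf
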